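import Summits.Ventures.PercRepro.C026Pairing

/-!
# The pendant reduction for C-026 (mine-3 dossier §8 / §11 S4) (p5, gen 7)

If `c` is pendant at `w` (every edge at `c` joins `c` and `w`, and there is one), the class lemma `(CF)`
for the marks `(a, b, c)` is equivalent to the class lemma for `(a, b, w)` on the configurations with
the star at `c` closed (= the class lemma of `G − c`).  Edge-by-edge split on the star at `c`:

* connectivity away from `c` ignores the star (`conn_closeStar_iff`); with a star edge open, `c ~ w`
  (`conn_c_w_of_star_open`); with the star closed, `c` is isolated (`eq_c_of_conn_of_starClosed`);
* the cells of `(a, b, c)` on a configuration `S` in terms of `S ∖ E_c` and the star: `lhs_iff`, `rhs_iff`;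
* **`pendant_reduction`**: with `N = 2^{|E_c|}` star configurations, `#LHS = X + (N − 1)·A` and
  `#RHS = X + (N − 1)·B` (`X` = the star-closed `a ~ b` configurations), so `(CF)_G(a, b, c) ⟺ A ≤ B`.

Part A of `C026Pendant` (split for the ≤ 400-line lint; proofs byte-identical) — the last part `C026Pendant.lean` imports it.
-/

namespace PercRepro

open Finset

namespace MultiGraph

section Pendant

variable {V E : Type*} (G : MultiGraph V E)

/-- `c` is **pendant at `w`**: every edge at `c` joins `c` and `w`, and there is at least one. -/
def Pendant (c w : V) : Prop :=
  (∀ e, e ∈ G.edgesAt ({c} : Set V) → (G.fst e = c ∧ G.snd e = w) ∨ (G.fst e = w ∧ G.snd e = c)) ∧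
    ∃ e, e ∈ G.edgesAt ({c} : Set V)

open Classical in
/-- `S ∖ E_c`: every edge at `c` closed (a local copy of `closeStar`, to keep the imports light). -/
noncomputable def closeStar (c : V) (S : Config E) : Config E :=
  fun e => if e ∈ G.edgesAt ({c} : Set V) then false else S e

/-- `closeStar` on an edge at `c`. -/
theorem closeStar_apply_of_mem {c : V} {S : Config E} {e : E} (he : e ∈ G.edgesAt ({c} : Set V)) :
    G.closeStar c S e = false := by
  simp [closeStar, he]

/-- `closeStar` away from `c`. -/
theorem closeStar_apply_of_notMem {c : V} {S : Config E} {e : E} (he : e ∉ G.edgesAt ({c} : Set V)) :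
    G.closeStar c S e = S e := by
  simp [closeStar, he]

/-- `closeStar c S ≤ S`. -/
theorem closeStar_le (c : V) (S : Config E) : G.closeStar c S ≤ S := by
  intro e
  by_cases he : e ∈ G.edgesAt ({c} : Set V)
  · rw [G.closeStar_apply_of_mem he]
    exact Bool.false_le _
  · rw [G.closeStar_apply_of_notMem he]

/-- The star at `c` is closed. -/
def StarClosed (c : V) (S : Config E) : Prop := ∀ e, e ∈ G.edgesAt ({c} : Set V) → S e = false

/-- The star at `c` is open. -/
def StarOpen (c : V) (S : Config E) : Prop := ∀ e, e ∈ G.edgesAt ({c} : Set V) → S e = true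

/-- **Connectivity away from `c` ignores the star**: for `u, v ≠ c`, `u ~_S v ⟺ u ~ v` in `S ∖ E_c`
(a detour through the pendant `c` enters and leaves through `w`). -/
theorem conn_closeStar_iff {c w : V} (hp : G.Pendant c w) (hcw : c ≠ w) {S : Config E} {u v : V}
    (hu : u ≠ c) (hv : v ≠ c) : G.Conn S u v ↔ G.Conn (G.closeStar c S) u v := by
  constructor
  · intro h
    -- motive: off `c` the closed-star path is there; at `c` it reaches `w`
    suffices key : (v = c → G.Conn (G.closeStar c S) u w) ∧ (v ≠ c → G.Conn (G.closeStar c S) u v) from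
      key.2 hv
    refine Conn.induction (motive := fun x => (x = c → G.Conn (G.closeStar c S) u w) ∧
      (x ≠ c → G.Conn (G.closeStar c S) u x)) ⟨fun hx => absurd hx hu, fun _ => Conn.refl G _ u⟩ ?_ h
    intro x y _ hxy ⟨hxc, hxn⟩
    obtain ⟨e, he, hend⟩ := hxy
    by_cases hec : e ∈ G.edgesAt ({c} : Set V)
    · -- a star edge: `{x, y} = {c, w}`
      have hj := hp.1 e hec
      have hxy' : (x = c ∧ y = w) ∨ (x = w ∧ y = c) := by
        rcases hj with ⟨h1, h2⟩ | ⟨h1, h2⟩ <;> rcases hend with ⟨h3, h4⟩ | ⟨h3, h4⟩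
        · exact Or.inl ⟨h3 ▸ h1, h4 ▸ h2⟩
        · exact Or.inr ⟨h4 ▸ h2, h3 ▸ h1⟩
        · exact Or.inr ⟨h3 ▸ h1, h4 ▸ h2⟩
        · exact Or.inl ⟨h4 ▸ h2, h3 ▸ h1⟩
      rcases hxy' with ⟨rfl, rfl⟩ | ⟨rfl, rfl⟩
      · exact ⟨fun h' => absurd h' hcw.symm, fun _ => hxc rfl⟩
      · exact ⟨fun _ => hxn hcw.symm, fun h' => absurd rfl h'⟩
    · -- an edge away from `c`: open in `S ∖ E_c`, endpoints `≠ c`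
      have hopen : G.closeStar c S e = true := by
        rw [G.closeStar_apply_of_notMem hec]
        exact he
      have hxc' : x ≠ c := by
        rintro rfl
        apply hec
        rcases hend with ⟨h1, _⟩ | ⟨_, h2⟩
        · exact Or.inl (by rw [h1]; rfl)
        · exact Or.inr (by rw [h2]; rfl)
      have hyc' : y ≠ c := by
        rintro rfl
        apply hec
        rcases hend with ⟨_, h2⟩ | ⟨h1, _⟩
        · exact Or.inr (by rw [h2]; rfl)
        · exact Or.inl (by rw [h1]; rfl)
      exact ⟨fun h' => absurd h' hyc', fun _ => (hxn hxc').trans (Conn.of_openAdj ⟨e, hopen, hend⟩)⟩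
  · intro h
    exact Conn.mono (G.closeStar_le c S) h

/-- With a star edge open, `c ~ w`. -/
theorem conn_c_w_of_star_open {c w : V} (hp : G.Pendant c w) {S : Config E} {e : E}
    (he : e ∈ G.edgesAt ({c} : Set V)) (hopen : S e = true) : G.Conn S c w :=
  Conn.of_openAdj ⟨e, hopen, hp.1 e he⟩

/-- With the star closed, `c` is isolated. -/
theorem eq_c_of_conn_of_starClosed {c : V} {S : Config E} (hS : G.StarClosed c S) {v : V}
    (h : G.Conn S c v) : v = c :=
  eq_of_conn_of_isolated (fun e he => by
    by_contra hcon
    have : e ∈ G.edgesAt ({c} : Set V) := by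
      simp only [edgesAt, Set.mem_setOf_eq, Set.mem_singleton_iff]
      tauto
    rw [hS e this] at he
    exact absurd he (by decide)) h

/-- `S ∖ E_c` is star-closed. -/
theorem starClosed_closeStar (c : V) (S : Config E) : G.StarClosed c (G.closeStar c S) :=
  fun _ he => G.closeStar_apply_of_mem he

/-- Closing the star of the complement: `closeStar c Sᶜ = closeStar c (closeStar c S)ᶜ`. -/
theorem closeStar_compl_closeStar (c : V) (S : Config E) :
    G.closeStar c Sᶜ = G.closeStar c (G.closeStar c S)ᶜ := by
  funext e
  by_cases he : e ∈ G.edgesAt ({c} : Set V)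
  · rw [G.closeStar_apply_of_mem he, G.closeStar_apply_of_mem he]
  · rw [G.closeStar_apply_of_notMem he, G.closeStar_apply_of_notMem he, compl_apply_not,
      compl_apply_not, G.closeStar_apply_of_notMem he]


/-! ### The cells of `(a, b, c)` through `S ∖ E_c` and the star -/

/-- A star-closed configuration is its own `S ∖ E_c`. -/
theorem closeStar_eq_self_of_starClosed {c : V} {S : Config E} (hS : G.StarClosed c S) :
    G.closeStar c S = S := by
  funext e
  by_cases he : e ∈ G.edgesAt ({c} : Set V)
  · rw [G.closeStar_apply_of_mem he, hS e he]
  · rw [G.closeStar_apply_of_notMem he]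

/-- **The left side**: `a ~_S b ∧ c iso in S̄ ⟺ a ~ b in S ∖ E_c ∧ (star open ∨ w iso in (S ∖ E_c)ᶜ)`. -/
theorem lhs_iff {c w : V} (hp : G.Pendant c w) (hcw : c ≠ w) {a b : V} (hac : a ≠ c) (hbc : b ≠ c)
    (S : Config E) :
    (G.Conn S a b ∧ G.IsCIso Sᶜ a b c) ↔
      (G.Conn (G.closeStar c S) a b ∧ (G.StarOpen c S ∨ G.IsCIso (G.closeStar c S)ᶜ a b w)) := by
  rw [G.conn_closeStar_iff hp hcw hac hbc]
  refine and_congr_right fun _ => ?_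
  by_cases hopen : G.StarOpen c S
  · -- the star is closed in `Sᶜ`: `c` is isolated there
    have hcl : G.StarClosed c Sᶜ := fun e he => by
      rw [compl_apply_not, hopen e he]
      rfl
    constructor
    · intro _
      exact Or.inl hopen
    · intro _
      refine ⟨fun h => hac (G.eq_c_of_conn_of_starClosed hcl h.symm),
        fun h => hbc (G.eq_c_of_conn_of_starClosed hcl h.symm)⟩
  · -- some star edge is closed in `S`, open in `Sᶜ`: `c ~ w` there
    obtain ⟨e, he, hne⟩ : ∃ e, e ∈ G.edgesAt ({c} : Set V) ∧ S e ≠ true := by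
      by_contra hcon
      push Not at hcon
      exact hopen fun e he => hcon e he
    have hcw' : G.Conn Sᶜ c w := G.conn_c_w_of_star_open hp he (by
      rw [compl_apply_not]
      cases h : S e
      · rfl
      · exact absurd h hne)
    have key : ∀ u, u ≠ c → (G.Conn Sᶜ u c ↔ G.Conn (G.closeStar c S)ᶜ u w) := by
      intro u huc
      have hcl' : G.closeStar c Sᶜ = G.closeStar c (G.closeStar c S)ᶜ := G.closeStar_compl_closeStar c S
      rw [G.conn_closeStar_iff hp hcw (S := (G.closeStar c S)ᶜ) huc (Ne.symm hcw), ← hcl',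
        ← G.conn_closeStar_iff hp hcw huc (Ne.symm hcw)]
      exact ⟨fun h => h.trans hcw', fun h => h.trans hcw'.symm⟩
    rw [iff_comm]
    constructor
    · rintro (h | h)
      · exact absurd h hopen
      · exact ⟨fun h' => h.1 ((key a hac).mp h'), fun h' => h.2 ((key b hbc).mp h')⟩
    · rintro ⟨h1, h2⟩
      exact Or.inr ⟨fun h' => h1 ((key a hac).mpr h'), fun h' => h2 ((key b hbc).mpr h')⟩

/-- **The right side**: `OnePair_S(a, b, c) ⟺ (star closed ∧ a ~ b in S ∖ E_c) ∨ (star not closed ∧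
OnePair_{S ∖ E_c}(a, b, w))`. -/
theorem rhs_iff {c w : V} (hp : G.Pendant c w) (hcw : c ≠ w) {a b : V} (hac : a ≠ c) (hbc : b ≠ c)
    (S : Config E) :
    G.OnePair S a b c ↔
      ((G.StarClosed c S ∧ G.Conn (G.closeStar c S) a b) ∨
        (¬ G.StarClosed c S ∧ G.OnePair (G.closeStar c S) a b w)) := by
  by_cases hcl : G.StarClosed c S
  · rw [G.closeStar_eq_self_of_starClosed hcl]
    have hac' : ¬ G.Conn S a c := fun h => hac (G.eq_c_of_conn_of_starClosed hcl h.symm)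
    have hbc' : ¬ G.Conn S b c := fun h => hbc (G.eq_c_of_conn_of_starClosed hcl h.symm)
    unfold OnePair
    constructor
    · rintro (h | h | h)
      · exact Or.inl ⟨hcl, h.1⟩
      · exact absurd h.1 hac'
      · exact absurd h.1 hbc'
    · rintro (⟨_, h⟩ | ⟨h, _⟩)
      · exact Or.inl ⟨h, hac'⟩
      · exact absurd hcl h
  · obtain ⟨e, he, hne⟩ : ∃ e, e ∈ G.edgesAt ({c} : Set V) ∧ S e ≠ false := by
      by_contra hcon
      push Not at hcon
      exact hcl fun e he => hcon e he
    have hcw' : G.Conn S c w := G.conn_c_w_of_star_open hp he (by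
      cases h : S e
      · exact absurd h hne
      · rfl)
    have kac : G.Conn S a c ↔ G.Conn (G.closeStar c S) a w := by
      rw [← G.conn_closeStar_iff hp hcw hac (Ne.symm hcw)]
      exact ⟨fun h => h.trans hcw', fun h => h.trans hcw'.symm⟩
    have kbc : G.Conn S b c ↔ G.Conn (G.closeStar c S) b w := by
      rw [← G.conn_closeStar_iff hp hcw hbc (Ne.symm hcw)]
      exact ⟨fun h => h.trans hcw', fun h => h.trans hcw'.symm⟩
    have kab : G.Conn S a b ↔ G.Conn (G.closeStar c S) a b := G.conn_closeStar_iff hp hcw hac hbc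
    unfold OnePair
    rw [kac, kbc, kab]
    constructor
    · intro h
      exact Or.inr ⟨hcl, h⟩
    · rintro (⟨h, _⟩ | ⟨_, h⟩)
      · exact absurd h hcl
      · exact h

end Pendant

end MultiGraph

end PercRepro
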